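import Summits.QuantumFields.YangMills.Theorems.UnitScaleTiltProp7TwistedSliceTangent
import Summits.QuantumFields.YangMills.Theorems.UnitScaleTiltProp7SymAvgTwSymSlice
import HarnessLib

/-!
# Route `UnitScaleTilt`, crux K1 child «MinimiserStabilityRegPr» (stmt-QuantumFields-19200), skeleton v10, stub `stub_existenceMinimalOrbit` (EX), route (α) — **THE EXACT HALF OF THE
# `hsplit` TRANSPORT: A DIRECTION TANGENT TO THE TWISTED SLICE AT `A₁` IS, AFTER THE VELOCITY MAP, FIBRE-TANGENT AT `U′` UP TO A GAUGE DIRECTION** (brick T3 of the chart-side TRANSPORT of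
# `hXtw‴`(iii); junction ★★`Prop7TangentCriticalSplit.tangentCritical_su2_of_split` (`W := U′`, `Ker := ker QSym U′`), LOCATE memo `LOCATE-TRANSPORT-LIN-w5g6.md` (E2)).

Cell `ym3-torus`, width seat `ym-ust-20520-w5` (gen 6).  THEOREMS ONLY (0 `def`, 0 `sorry`).  `--supports stmt-QuantumFields-19200 --as helper`, count-neutral.  YM₃ on T³ is a ladder rung (R3), not
the Clay problem; nothing here claims the stub, the crux, d = 4 or the mass gap.

THE POINT.  T2 (✓`Prop7TwistedSliceTangent.fderiv_logChartTwS_apply_eq_zero_iff_of_regPr`) says: `α` is tangent to the twisted slice `{logChartTwS U₀ = B}` at `A₁` iff the straight linearised average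
at `U′ = e^{A₁}U₀` of its velocity `Mα = g(ad(−A₁))α` is the coarse gauge motion of `D̄(U′)` generated by the frame response `λ_α`.  By the covariance of the averages (✓`QSym_gaugeDir_of_regPr`: `QSym U′ (G_{U′}N) =`
coarse gauge motion generated by `N` read at the comparison sites) the SAME coarse motion is produced by the fine gauge direction `G_{U′}(N)` of ANY `N` extending `λ_α` from the comparison sites
(`N(x̂_y) = λ_α(y)`; the sites are distinct, ✓`embIter_injective`).  Hence `Mα − G_{U′}(N) ∈ ker QSym(U′)`: **`M(T_{A₁}Σˢ) ⊆ ker QSym(U′) + 𝒢_{U′}`, exactly, with no estimate** — the inclusion (E2) of the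
memo.  The converse inclusion `ker QSym(U′) ⊆ M·Dχ(ker QTwS U₀ ∩ Landau₀) + 𝒢_{U′}` (= `hsplit`) is the located residue ((R-𝓚)/(TRANS) of the memo: response of the symmetric frame tower to gauge directions).

WHAT IS PROVED (sorry-free, no definition): ★★★`exists_gaugeDir_QSym_velocity_sub_eq_zero_of_slice_tangent` — at printed-regular `U₀ ∈ 𝔘_k(ε₀)`, `U′ ∈ 𝔘_k(ε₀′)` (`10¹²L³ε₀ ≤ 1`, `10⁹L²e ≤ 1`,
`10⁷L³ε₀′ ≤ 1`), `‖A₁‖ < e·η`, `U′(b) = e^{A₁(b)}U₀(b)`: if `fderiv ℂ (logChartTwS U₀) A₁ α = 0` then `∃ N` with `N(x̂_y) = λ_α(y)` for every comparison site `y` and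
`QSym U′ ((b ↦ g(ad(−A₁ b))(α b)) − (b ↦ N(b₋) − U′♭(b)·N(b₊)·U′♭(b)⁻¹)) = 0`.
HONEST SCOPE: exact bookkeeping over T2 + ✓`QSym_gaugeDir_of_regPr`; `N` is the zero extension off the comparison sites (any extension works); reality of `N` (for 𝔰𝔲(2) data) is the frames'
unitarity (✓`Prop7SymFrameUnitary`), not restated here; nothing of print is asserted.

References: T. Bałaban, CMP 98 (1985) 17–51 [Balaban1985Averaging] ((11) p.19, (87) p.31, (97) p.32); CMP 102 (1985) 277–309 [Balaban1985Variational] ((44)–(49) p.285, (82)–(83) p.290).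
-/

set_option autoImplicit false

noncomputable section

open scoped BigOperators Matrix.Norms.L2Operator Matrix Topology RightActions
open Filter

namespace Summit.QuantumFields.YangMills.Theorems.Prop7TwistedSliceGaugeCorrection

open NormedSpace
open Literature.MathematicalPhysics.QuantumFieldTheory.Balaban1983to89
open Literature.MathematicalPhysics.QuantumFieldTheory.Balaban1983to89.T3ContinuumYM3Torus
open Literature.MathematicalPhysics.QuantumFieldTheory.Balaban1983to89.T3SectALandauChart (bgUnits eta eta_pos)
open Literature.MathematicalPhysics.QuantumFieldTheory.Balaban1983to89.T3PrintedRegularMinimiser (RegPr)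
open B7Prop1Explicit (expUnit val_expUnit)
open Summit.QuantumFields.YangMills.Theorems.Prop7SymAvgGL (descendToGL)
open Summit.QuantumFields.YangMills.Theorems.Prop7SymAvgTwSym (frameTwS dbarTwS logChartTwS)
open Summit.QuantumFields.YangMills.Theorems.Prop7TwistedSliceTangent (fderiv_logChartTwS_apply_eq_zero_iff_of_regPr)
/-! ## §1 Slice-tangent ⟹ fibre-tangent up to a gauge direction at `U′` -/

section GaugeCorrection

open Literature.Analysis.Calculus.ExpDifferential (ad gSer)
open T3LevelShift (siteShift)
open T3PrintedRegularOrbits (sites_eq)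
open B15DeterminingSets (embIter)
open Summit.QuantumFields.YangMills.Theorems.Prop7SymAvgGL (QSym)
open Summit.QuantumFields.YangMills.Theorems.Prop7SymAvgRelDiffT3 (hasFDerivAt_rel_of_regPr QSym_gaugeDir_of_regPr)
open Summit.QuantumFields.YangMills.Theorems.Prop7SymAvgTwGaugeDir (hasFDerivAt_logChartSym)
open Summit.QuantumFields.YangMills.Theorems.Prop7SymAvgTwSymSlice (embIter_injective)

variable (F : T3Family) {n K : ℕ} (h : n ≤ K)

/-- ★★★ **SLICE-TANGENT ⟹ FIBRE-TANGENT UP TO A GAUGE DIRECTION AT `U′` (exact, no estimate).**  In the setting of `fderiv_logChartTwS_apply_eq_zero_iff_of_regPr`: if `α` is tangent to the twisted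
slice at `A₁` (`D(logChartTwS U₀)(A₁) α = 0`), then for the fine gauge parameter `N` extending the frame response `λ_α` from the comparison sites (`N(x̂_y) = λ_α(y)`, zero elsewhere) the velocity
`Mα` minus the gauge direction `G_{U′}(N) = (b ↦ N(b₋) − U′(b)N(b₊)U′(b)⁻¹)` lies in `ker QSym(U′)`: `QSym U′ (Mα − G_{U′}N) = 0`.  Proof: T2 §5 gives `QSym U′ (Mα)(c) = λ_α(ĉ₋)… ` as the coarse gauge direction of
`λ_α` at `D̄(U′)`, and ✓`QSym_gaugeDir_of_regPr` gives the same for `QSym U′ (G_{U′}N)`.  This is the exact half of the `hsplit` transport: `M(S) ⊆ ker QSym(U′) + 𝒢_{U′}`.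
[cite: Balaban1985Averaging, (11) p.19, (87) p.31, (97) p.32; Balaban1985Variational, (44)-(49) p.285, (82)-(83) p.290] -/
theorem exists_gaugeDir_QSym_velocity_sub_eq_zero_of_slice_tangent {ε₀ ε₀' e : ℝ} (hε₀ : 0 < ε₀) (he : 0 < e) (hWe : 10 ^ 9 * (F.L : ℝ) ^ 2 * e ≤ 1) (hWε : 10 ^ 12 * (F.L : ℝ) ^ 3 * ε₀ ≤ 1)
    (hε₀' : 0 < ε₀') (hε' : 10 ^ 7 * (F.L : ℝ) ^ 3 * ε₀' ≤ 1)
    (U₀ U' : GaugeField (F.P K) 0 (Matrix.specialUnitaryGroup (Fin 2) ℂ)) (hreg : RegPr F n K ε₀ U₀) (hreg' : RegPr F n K ε₀' U')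
    (A₁ : PBond (F.P K) 0 → Matrix (Fin 2) (Fin 2) ℂ) (hA₁ : ‖A₁‖ < e * eta F n K)
    (hU' : ∀ b, ((U' b : Matrix.specialUnitaryGroup (Fin 2) ℂ) : Matrix (Fin 2) (Fin 2) ℂ) = exp (A₁ b) * ((U₀ b : Matrix.specialUnitaryGroup (Fin 2) ℂ) : Matrix (Fin 2) (Fin 2) ℂ))
    (α : PBond (F.P K) 0 → Matrix (Fin 2) (Fin 2) ℂ) (hα : fderiv ℂ (logChartTwS F n K h U₀) A₁ α = 0) :
    ∃ N : Site (F.P K) 0 → Matrix (Fin 2) (Fin 2) ℂ,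
      (∀ y : Site (F.P n) 0, N (embIter (K - n) (siteShift (sites_eq F n K h) y))
          = fderiv ℂ (fun A : PBond (F.P K) 0 → Matrix (Fin 2) (Fin 2) ℂ => ((frameTwS F n K h U₀ A y : (Matrix (Fin 2) (Fin 2) ℂ)ˣ) : Matrix (Fin 2) (Fin 2) ℂ)) A₁ α *
              (((frameTwS F n K h U₀ A₁ y)⁻¹ : (Matrix (Fin 2) (Fin 2) ℂ)ˣ) : Matrix (Fin 2) (Fin 2) ℂ)) ∧
      QSym F n K h U' ((fun b : PBond (F.P K) 0 => gSer ℂ (ad ℂ (-A₁ b)) (α b))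
          - fun b : PBond (F.P K) 0 => N b.src - ((bgUnits F K U' b : (Matrix (Fin 2) (Fin 2) ℂ)ˣ) : Matrix (Fin 2) (Fin 2) ℂ) * N b.tgt *
              (((bgUnits F K U' b)⁻¹ : (Matrix (Fin 2) (Fin 2) ℂ)ˣ) : Matrix (Fin 2) (Fin 2) ℂ)) = 0 := by
  -- T2 §5 at `α`, then name the frame response `λ_α`
  have hT2 := (fderiv_logChartTwS_apply_eq_zero_iff_of_regPr F h hε₀ he hWe hWε hε₀' hε' U₀ U' hreg hreg' A₁ hA₁ hU' α).1 hα
  set lam : Site (F.P n) 0 → Matrix (Fin 2) (Fin 2) ℂ := fun y =>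
    fderiv ℂ (fun A : PBond (F.P K) 0 → Matrix (Fin 2) (Fin 2) ℂ => ((frameTwS F n K h U₀ A y : (Matrix (Fin 2) (Fin 2) ℂ)ˣ) : Matrix (Fin 2) (Fin 2) ℂ)) A₁ α *
      (((frameTwS F n K h U₀ A₁ y)⁻¹ : (Matrix (Fin 2) (Fin 2) ℂ)ˣ) : Matrix (Fin 2) (Fin 2) ℂ) with hlam
  -- the extension `N` of `λ_α` from the comparison sites (distinct by `embIter_injective`)
  have hKn : K - n ≤ (F.P K).m + (F.P K).K := by
    show K - n ≤ F.m + K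
    have := F.hm
    omega
  have hinj : Function.Injective fun y : Site (F.P n) 0 => embIter (K - n) (siteShift (sites_eq F n K h) y) :=
    fun a b hab => (siteShift (sites_eq F n K h)).injective (embIter_injective (K - n) hKn hab)
  refine ⟨Function.extend (fun y : Site (F.P n) 0 => embIter (K - n) (siteShift (sites_eq F n K h) y)) lam 0, fun y => hinj.extend_apply lam 0 y, ?_⟩
  -- `QSym U′` is the derivative of the `U′`-based relative average
  have hG := hasFDerivAt_rel_of_regPr F h hε₀' hε' U' hreg'
  have hQ : QSym F n K h U' = fderiv ℂ (fun A : PBond (F.P K) 0 → Matrix (Fin 2) (Fin 2) ℂ => fun c : PBond (F.P n) 0 =>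
        ((descendToGL F n K h (fun b => expUnit (A b) * bgUnits F K U' b) c : (Matrix (Fin 2) (Fin 2) ℂ)ˣ) : Matrix (Fin 2) (Fin 2) ℂ) *
          (((descendToGL F n K h (bgUnits F K U') c)⁻¹ : (Matrix (Fin 2) (Fin 2) ℂ)ˣ) : Matrix (Fin 2) (Fin 2) ℂ)) 0 :=
    (hasFDerivAt_logChartSym F h U' hG).fderiv
  -- the gauge row at `U′`
  have hgauge := QSym_gaugeDir_of_regPr F h hε₀' hε' U' hreg' (Function.extend (fun y : Site (F.P n) 0 => embIter (K - n) (siteShift (sites_eq F n K h) y)) lam 0)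
  rw [map_sub, hgauge, hQ]
  funext c
  have h1 : Function.extend (fun y : Site (F.P n) 0 => embIter (K - n) (siteShift (sites_eq F n K h) y)) lam 0
      (embIter (K - n) (siteShift (sites_eq F n K h) c.src)) = lam c.src := hinj.extend_apply lam 0 c.src
  have h2 : Function.extend (fun y : Site (F.P n) 0 => embIter (K - n) (siteShift (sites_eq F n K h) y)) lam 0
      (embIter (K - n) (siteShift (sites_eq F n K h) c.tgt)) = lam c.tgt := hinj.extend_apply lam 0 c.tgt
  rw [Pi.sub_apply, Pi.zero_apply]
  erw [h1, h2]
  -- unit letters at `c` and T2's identity, solved for the straight average of the velocity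
  set D' : (Matrix (Fin 2) (Fin 2) ℂ)ˣ := descendToGL F n K h (bgUnits F K U') c with hD'
  set P₀ : (Matrix (Fin 2) (Fin 2) ℂ)ˣ := descendToGL F n K h (bgUnits F K U₀) c with hP₀
  have hc := hT2 c
  have hX : fderiv ℂ (fun A : PBond (F.P K) 0 → Matrix (Fin 2) (Fin 2) ℂ => fun c : PBond (F.P n) 0 =>
        ((descendToGL F n K h (fun b => expUnit (A b) * bgUnits F K U' b) c : (Matrix (Fin 2) (Fin 2) ℂ)ˣ) : Matrix (Fin 2) (Fin 2) ℂ) *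
          (((descendToGL F n K h (bgUnits F K U') c)⁻¹ : (Matrix (Fin 2) (Fin 2) ℂ)ˣ) : Matrix (Fin 2) (Fin 2) ℂ)) 0 (fun b => gSer ℂ (ad ℂ (-A₁ b)) (α b)) c
      = lam c.src - (D' : Matrix (Fin 2) (Fin 2) ℂ) * lam c.tgt * ((D'⁻¹ : (Matrix (Fin 2) (Fin 2) ℂ)ˣ) : Matrix (Fin 2) (Fin 2) ℂ) := by
    have hone : ((D' : Matrix (Fin 2) (Fin 2) ℂ) * ((P₀⁻¹ : (Matrix (Fin 2) (Fin 2) ℂ)ˣ) : Matrix (Fin 2) (Fin 2) ℂ)) *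
        ((P₀ : Matrix (Fin 2) (Fin 2) ℂ) * ((D'⁻¹ : (Matrix (Fin 2) (Fin 2) ℂ)ˣ) : Matrix (Fin 2) (Fin 2) ℂ)) = 1 := by
      simp only [mul_assoc, Units.inv_mul_cancel_left, Units.mul_inv]
    calc fderiv ℂ (fun A : PBond (F.P K) 0 → Matrix (Fin 2) (Fin 2) ℂ => fun c : PBond (F.P n) 0 =>
            ((descendToGL F n K h (fun b => expUnit (A b) * bgUnits F K U' b) c : (Matrix (Fin 2) (Fin 2) ℂ)ˣ) : Matrix (Fin 2) (Fin 2) ℂ) *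
              (((descendToGL F n K h (bgUnits F K U') c)⁻¹ : (Matrix (Fin 2) (Fin 2) ℂ)ˣ) : Matrix (Fin 2) (Fin 2) ℂ)) 0 (fun b => gSer ℂ (ad ℂ (-A₁ b)) (α b)) c
        = fderiv ℂ (fun A : PBond (F.P K) 0 → Matrix (Fin 2) (Fin 2) ℂ => fun c : PBond (F.P n) 0 =>
            ((descendToGL F n K h (fun b => expUnit (A b) * bgUnits F K U' b) c : (Matrix (Fin 2) (Fin 2) ℂ)ˣ) : Matrix (Fin 2) (Fin 2) ℂ) *
              (((descendToGL F n K h (bgUnits F K U') c)⁻¹ : (Matrix (Fin 2) (Fin 2) ℂ)ˣ) : Matrix (Fin 2) (Fin 2) ℂ)) 0 (fun b => gSer ℂ (ad ℂ (-A₁ b)) (α b)) c *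
            (((D' : Matrix (Fin 2) (Fin 2) ℂ) * ((P₀⁻¹ : (Matrix (Fin 2) (Fin 2) ℂ)ˣ) : Matrix (Fin 2) (Fin 2) ℂ)) *
              ((P₀ : Matrix (Fin 2) (Fin 2) ℂ) * ((D'⁻¹ : (Matrix (Fin 2) (Fin 2) ℂ)ˣ) : Matrix (Fin 2) (Fin 2) ℂ))) := by rw [hone, mul_one]
      _ = (lam c.src * ((D' : Matrix (Fin 2) (Fin 2) ℂ) * ((P₀⁻¹ : (Matrix (Fin 2) (Fin 2) ℂ)ˣ) : Matrix (Fin 2) (Fin 2) ℂ))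
            - ((D' : Matrix (Fin 2) (Fin 2) ℂ) * ((P₀⁻¹ : (Matrix (Fin 2) (Fin 2) ℂ)ˣ) : Matrix (Fin 2) (Fin 2) ℂ)) *
              ((P₀ : Matrix (Fin 2) (Fin 2) ℂ) * lam c.tgt * ((P₀⁻¹ : (Matrix (Fin 2) (Fin 2) ℂ)ˣ) : Matrix (Fin 2) (Fin 2) ℂ))) *
            ((P₀ : Matrix (Fin 2) (Fin 2) ℂ) * ((D'⁻¹ : (Matrix (Fin 2) (Fin 2) ℂ)ˣ) : Matrix (Fin 2) (Fin 2) ℂ)) := by rw [← mul_assoc, hc]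
      _ = lam c.src - (D' : Matrix (Fin 2) (Fin 2) ℂ) * lam c.tgt * ((D'⁻¹ : (Matrix (Fin 2) (Fin 2) ℂ)ˣ) : Matrix (Fin 2) (Fin 2) ℂ) := by
        rw [sub_mul]
        simp only [mul_assoc, Units.inv_mul_cancel_left, Units.mul_inv, mul_one]
  rw [hX, hD']
  exact sub_self _

end GaugeCorrection
end Summit.QuantumFields.YangMills.Theorems.Prop7TwistedSliceGaugeCorrection

end
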